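import Mathlib.Analysis.SpecialFunctions.SmoothTransition
import Mathlib.Analysis.SpecialFunctions.Sqrt
import Literature.Topology.FourManifolds.ConcordanceStripFrame
import Literature.Topology.FourManifolds.StraightLineIsotopyExtension
import HarnessLib

/-!
# The tube of a vertical strip of a concordance annulus

Topic `Literature/Topology/FourManifolds`; sequel of `ConcordanceStripFrame.lean` in the
decomposition of the Fox–Milnor congruence
`Literature.Topology.FourManifolds.Knot.IsConnectedSum.isConcordant` (`BandSum.lean`,
`BandSumConcordance.lean`, `BandSumConcordanceCore.lean`), branch "a small copy of the second
factor carried along a concordance of the first factor". The carrier is a **tube**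
`((θ, t), (d₁, d₂)) ↦ Θ ((θ, t), d) ∈ ℝ⁴` around a vertical strip of the lifted annulus
`F : ℝ × ℝ → ℝ⁴` of a concordance which is *conical beyond the seams*
(`Knot.IsConcordance.exists_conical`, `ConcordanceStraighteningBoth.lean`: `F (θ, t) = t • k₁ θ`
for `t ≤ 1 + δ`, `= t • k₂ θ` for `t ≥ 2 - δ`, `k₁`, `k₂` the unit curves of the end knots),
recorded with the general-position vector `w` of `StripFrame.exists_frame_strip` as a
`Literature.Topology.FourManifolds.StripFrame.TubeSetup`. Everything is proved:

* `TubeSetup.affTube` — the affine tube `F + d₁ n₁ + d₂ n₂` on the normal frame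
  `(n₁, n₂) = (frame₁ F w, frame₂ F w)`; `TubeSetup.coneTube k` — `t` times the radial
  projection to `𝕊³` of `k θ + d₁ M₁ θ + d₂ M₂ θ`, the cone over the tube of the unit curve `k`
  with the framing `(M₁, M₂) = (normalPart k' k w, triCross k' k M₁)` (norm of the affine part
  `≥ 1`, `one_le_norm_coneAff`, so no cut-off is needed); `TubeSetup.tube` — the blend
  `(1 - χ₁ - χ₂) • affTube + χ₁ • coneTube k₁ + χ₂ • coneTube k₂` by two smooth time cut-offs
  supported in the cones. It is `C^∞` on all of `(ℝ × ℝ) × (ℝ × ℝ)` (`contDiff_tube`), restricts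
  to `F` on the zero section (`tube_zero`), and **is the cone over the `𝕊³`-tube of `k₁`
  (resp. `k₂`) for all `t ≤ 1 + δ/4` (resp. `t ≥ 2 - δ/4`)** (`tube_of_le`, `tube_of_ge`), in
  particular level preserving there (`norm_tube_of_le/ge`): the new annulus built inside the tube
  will be conical near its ends, hence neat, with end knots read in the `𝕊³`-tubes.
* `TubeSetup.hasFDerivAt_tube`, `TubeSetup.tubeDeriv` — along the zero section the derivative is
  `(v, e) ↦ DF(q) v + e₁ V₁ q + e₂ V₂ q` where `Vᵢ` blends `nᵢ` with `t Mᵢ`; the point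
  (`n₁_n₂_of_fderiv_eq`, homogeneity `normalPart_smul_left`, `triCross_smul_left_right`) is that
  on the cones `n₁ = t² M₁`, `n₂ = t³ M₂`, so `Vᵢ` is a *positive* multiple of `nᵢ`
  (`exists_V_eq_smul`) and the derivative is injective wherever `F` is an immersion and
  `frame₁ ≠ 0` (`injective_tubeDeriv`, from `StripFrame.eq_zero_of_combination_eq_zero`). The
  derivative of the radial projection at a unit vector (`hasFDerivAt_normalize`) and of the cone
  `t • k θ` (`hasFDerivAt_cone`) are computed on the way.
* `TubeSetup.exists_nhds_injOn` (inverse function theorem at the zero section),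
  `TubeSetup.exists_injOn_tube` — **a uniform injective immersed tube around a compact framed
  strip on which `F` is injective** (injectivity spreads from the compact zero section,
  `exists_isOpen_injOn_of_isCompact` of `StraightLineIsotopyExtension.lean`, Hirsch (1976), Ch. 4
  §5, Ex. 5; uniform width by `generalized_tube_lemma`; injectivity of the derivative is an open
  condition, `ContinuousLinearMap.isOpen_injective`).

This is the tubular neighbourhood theorem (Hirsch (1976), Ch. 4 §5, Thm. 5.1) for the strip,
in explicit coordinates and with the extra structure (conical ends) the application needs; cf.
`FramedTubularNbhd.lean` for closed framed submanifolds of spheres.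

## References

* M. W. Hirsch, *Differential Topology*, GTM 33, Springer (1976), Ch. 4 §5, Thm. 5.1 and
  Ex. 5. [HirschDT1976]
* R. H. Fox, J. W. Milnor, *Singularities of 2-spheres in 4-space and cobordism of knots*, Osaka
  J. Math. 3 (1966), §1 (the consumer). [FoxMilnor1966]

## Design notes

* All hypotheses are bundled in the structure `TubeSetup` (data `F, k₁, k₂, w, δ` and the
  conical identities); the framing/injectivity hypotheses, which hold only on a strip, are
  arguments of the pointwise statements. No named facts, no `sorry`.
* Notation `𝔼 n` is local, byte-identical to `Knots.lean`.
-/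

open scoped Manifold ContDiff Topology RealInnerProductSpace
open Function Set

noncomputable section

namespace Literature.Topology.FourManifolds

/-- Local notation: `𝔼 n` is the model Euclidean space `EuclideanSpace ℝ (Fin n)`. -/
local notation "𝔼 " n:arg => EuclideanSpace ℝ (Fin n)

namespace StripFrame

/-! ### Homogeneity of the normal part and of the triple cross product -/

section Homogeneity

variable (u v w : 𝔼 4) (s t : ℝ)

/-- Scaling the first vector scales the normal part quadratically. [folklore] -/
theorem normalPart_smul_left : normalPart (t • u) v w = (t * t) • normalPart u v w := by
  simp only [normalPart, real_inner_smul_left, real_inner_smul_right, smul_sub, smul_smul]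
  congr 1
  · congr 1
    · ring_nf
    · ring_nf
  · ring_nf

/-- The triple cross product is homogeneous in its first and third arguments. [folklore] -/
theorem triCross_smul_left_right :
    triCross (t • u) v (s • w) = (t * s) • triCross u v w := by
  ext i
  fin_cases i <;> simp [triCross] <;> ring

end Homogeneity

/-! ### Curves on the unit sphere of `ℝ⁴` -/

/-- A differentiable curve on the unit sphere is orthogonal to its velocity. [folklore] -/
theorem inner_deriv_eq_zero_of_norm_eq_one {k : ℝ → 𝔼 4} (hk : Differentiable ℝ k)
    (hn : ∀ θ, ‖k θ‖ = 1) (θ : ℝ) : ⟪k θ, deriv k θ⟫ = 0 := by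
  have hd : HasDerivAt k (deriv k θ) θ := (hk θ).hasDerivAt
  have h := hd.inner ℝ hd
  have hconst : (fun s ↦ ⟪k s, k s⟫) = fun _ ↦ (1 : ℝ) := by
    funext s
    rw [real_inner_self_eq_norm_sq, hn, one_pow]
  rw [hconst] at h
  have := h.unique (hasDerivAt_const θ (1 : ℝ))
  rw [real_inner_comm (deriv k θ)] at this
  rw [real_inner_comm]
  linarith

/-! ### The setup -/

/-- **Data of the tube construction along a strip of a concordance annulus.** `F` is the lifted
annulus (`annulusLift f` of a concordance `f`), conical at both ends *for all times beyond the
seams*: `F (θ, t) = t • k₁ θ` for `t ≤ 1 + δ` and `F (θ, t) = t • k₂ θ` for `t ≥ 2 - δ`, where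
`k₁`, `k₂` are the (unit-period, unit-norm) curves of the two end knots; `w` is the general
position vector of `exists_frame_strip`. No framing hypothesis is recorded here (the frame
`frame₁ F w`, `frame₂ F w` may degenerate off the strip); the pointwise statements below carry
the non-degeneracy where they need it. [folklore] -/
structure TubeSetup where
  /-- The lifted annulus `ℝ × ℝ → ℝ⁴`. -/
  F : ℝ × ℝ → 𝔼 4
  /-- The curve of the inner end knot. -/
  k₁ : ℝ → 𝔼 4
  /-- The curve of the outer end knot. -/
  k₂ : ℝ → 𝔼 4
  /-- The general position vector. -/
  w : 𝔼 4
  /-- The width of the cones. -/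
  δ : ℝ
  contDiff_F : ContDiff ℝ ∞ F
  contDiff_k₁ : ContDiff ℝ ∞ k₁
  contDiff_k₂ : ContDiff ℝ ∞ k₂
  norm_k₁ : ∀ θ, ‖k₁ θ‖ = 1
  norm_k₂ : ∀ θ, ‖k₂ θ‖ = 1
  δ_pos : 0 < δ
  δ_le : δ ≤ 1 / 4
  cone₁ : ∀ θ t : ℝ, t ≤ 1 + δ → F (θ, t) = t • k₁ θ
  cone₂ : ∀ θ t : ℝ, 2 - δ ≤ t → F (θ, t) = t • k₂ θ

namespace TubeSetup

variable (S : TubeSetup)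

/-! ### The two time cut-offs -/

/-- The inner cut-off: `1` for `t ≤ 1 + δ/4`, `0` for `t ≥ 1 + δ/2`. [folklore] -/
def χ₁ (t : ℝ) : ℝ :=
  Real.smoothTransition ((1 + S.δ / 2 - t) / (S.δ / 4))

/-- The outer cut-off: `0` for `t ≤ 2 - δ/2`, `1` for `t ≥ 2 - δ/4`. [folklore] -/
def χ₂ (t : ℝ) : ℝ :=
  Real.smoothTransition ((t - (2 - S.δ / 2)) / (S.δ / 4))

/-- The inner cut-off is `C^∞`. [folklore] -/
theorem contDiff_χ₁ : ContDiff ℝ ∞ S.χ₁ :=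
  Real.smoothTransition.contDiff.comp ((contDiff_const.sub contDiff_id).div_const _)

/-- The outer cut-off is `C^∞`. [folklore] -/
theorem contDiff_χ₂ : ContDiff ℝ ∞ S.χ₂ :=
  Real.smoothTransition.contDiff.comp ((contDiff_id.sub contDiff_const).div_const _)

/-- The inner cut-off is `1` up to `t = 1 + δ/4`. [folklore] -/
theorem χ₁_of_le {t : ℝ} (ht : t ≤ 1 + S.δ / 4) : S.χ₁ t = 1 := by
  unfold χ₁
  apply Real.smoothTransition.one_of_one_le
  rw [le_div_iff₀ (by linarith [S.δ_pos])]
  linarith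

/-- The inner cut-off vanishes from `t = 1 + δ/2` on. [folklore] -/
theorem χ₁_of_ge {t : ℝ} (ht : 1 + S.δ / 2 ≤ t) : S.χ₁ t = 0 := by
  unfold χ₁
  apply Real.smoothTransition.zero_of_nonpos
  exact div_nonpos_of_nonpos_of_nonneg (by linarith) (by linarith [S.δ_pos])

/-- The outer cut-off vanishes up to `t = 2 - δ/2`. [folklore] -/
theorem χ₂_of_le {t : ℝ} (ht : t ≤ 2 - S.δ / 2) : S.χ₂ t = 0 := by
  unfold χ₂
  apply Real.smoothTransition.zero_of_nonpos
  exact div_nonpos_of_nonpos_of_nonneg (by linarith) (by linarith [S.δ_pos])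

/-- The outer cut-off is `1` from `t = 2 - δ/4` on. [folklore] -/
theorem χ₂_of_ge {t : ℝ} (ht : 2 - S.δ / 4 ≤ t) : S.χ₂ t = 1 := by
  unfold χ₂
  apply Real.smoothTransition.one_of_one_le
  rw [le_div_iff₀ (by linarith [S.δ_pos])]
  linarith

/-- `0 ≤ χ₁`. [folklore] -/
theorem χ₁_nonneg (t : ℝ) : 0 ≤ S.χ₁ t := Real.smoothTransition.nonneg _
/-- `χ₁ ≤ 1`. [folklore] -/
theorem χ₁_le_one (t : ℝ) : S.χ₁ t ≤ 1 := Real.smoothTransition.le_one _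
/-- `0 ≤ χ₂`. [folklore] -/
theorem χ₂_nonneg (t : ℝ) : 0 ≤ S.χ₂ t := Real.smoothTransition.nonneg _
/-- `χ₂ ≤ 1`. [folklore] -/
theorem χ₂_le_one (t : ℝ) : S.χ₂ t ≤ 1 := Real.smoothTransition.le_one _

/-- Where the inner cut-off is nonzero, `t < 1 + δ/2` (inside the inner cone). [folklore] -/
theorem lt_of_χ₁_ne_zero {t : ℝ} (h : S.χ₁ t ≠ 0) : t < 1 + S.δ / 2 := by
  by_contra h'
  exact h (S.χ₁_of_ge (not_lt.1 h'))

/-- Where the outer cut-off is nonzero, `2 - δ/2 < t` (inside the outer cone). [folklore] -/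
theorem lt_of_χ₂_ne_zero {t : ℝ} (h : S.χ₂ t ≠ 0) : 2 - S.δ / 2 < t := by
  by_contra h'
  exact h (S.χ₂_of_le (not_lt.1 h'))

/-! ### The normal frames of the end cones -/

/-- The first normal field of the cone over the unit curve `k` at time `1`:
`normalPart (k' θ) (k θ) w`. [folklore] -/
def M₁ (k : ℝ → 𝔼 4) (θ : ℝ) : 𝔼 4 :=
  normalPart (deriv k θ) (k θ) S.w

/-- The second normal field of the cone over `k` at time `1`. [folklore] -/
def M₂ (k : ℝ → 𝔼 4) (θ : ℝ) : 𝔼 4 :=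
  triCross (deriv k θ) (k θ) (S.M₁ k θ)

section Cone

variable {k : ℝ → 𝔼 4}

/-- The velocity of a `C^∞` curve is `C^∞`. [folklore] -/
theorem _root_.Literature.Topology.FourManifolds.StripFrame.contDiff_deriv_curve
    (hk : ContDiff ℝ ∞ k) : ContDiff ℝ ∞ (deriv k) :=
  (contDiff_infty_iff_deriv.1 hk).2

/-- `M₁` is `C^∞` along a `C^∞` curve. [folklore] -/
theorem contDiff_M₁ (hk : ContDiff ℝ ∞ k) : ContDiff ℝ ∞ (S.M₁ k) :=
  contDiff_normalPart (contDiff_deriv_curve hk) hk contDiff_const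

/-- `M₂` is `C^∞` along a `C^∞` curve. [folklore] -/
theorem contDiff_M₂ (hk : ContDiff ℝ ∞ k) : ContDiff ℝ ∞ (S.M₂ k) :=
  contDiff_triCross (contDiff_deriv_curve hk) hk (S.contDiff_M₁ hk)

/-- `M₁ ⊥ k`. [folklore] -/
theorem inner_M₁_self (θ : ℝ) : ⟪S.M₁ k θ, k θ⟫ = 0 :=
  inner_normalPart_right _ _ _

/-- `M₁ ⊥ k'`. [folklore] -/
theorem inner_M₁_deriv (θ : ℝ) : ⟪S.M₁ k θ, deriv k θ⟫ = 0 :=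
  inner_normalPart_left _ _ _

/-- `M₂ ⊥ k`. [folklore] -/
theorem inner_M₂_self (θ : ℝ) : ⟪S.M₂ k θ, k θ⟫ = 0 :=
  inner_triCross_middle _ _ _

/-- `M₂ ⊥ k'`. [folklore] -/
theorem inner_M₂_deriv (θ : ℝ) : ⟪S.M₂ k θ, deriv k θ⟫ = 0 :=
  inner_triCross_left _ _ _

/-- `M₂ ⊥ M₁`. [folklore] -/
theorem inner_M₂_M₁ (θ : ℝ) : ⟪S.M₂ k θ, S.M₁ k θ⟫ = 0 :=
  inner_triCross_right _ _ _

end Cone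

/-! ### The affine tube, the cone tubes and the blended tube -/

/-- The first normal field of the annulus. [folklore] -/
abbrev n₁ : ℝ × ℝ → 𝔼 4 := frame₁ S.F S.w

/-- The second normal field of the annulus. [folklore] -/
abbrev n₂ : ℝ × ℝ → 𝔼 4 := frame₂ S.F S.w

/-- The **affine tube** `((θ, t), (d₁, d₂)) ↦ F (θ, t) + d₁ n₁ (θ, t) + d₂ n₂ (θ, t)`. [folklore] -/
def affTube (p : (ℝ × ℝ) × (ℝ × ℝ)) : 𝔼 4 :=
  S.F p.1 + p.2.1 • S.n₁ p.1 + p.2.2 • S.n₂ p.1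

/-- The affine part of a cone tube: `k θ + d₁ M₁ θ + d₂ M₂ θ` (norm `≥ 1`). [folklore] -/
def coneAff (k : ℝ → 𝔼 4) (p : (ℝ × ℝ) × (ℝ × ℝ)) : 𝔼 4 :=
  k p.1.1 + p.2.1 • S.M₁ k p.1.1 + p.2.2 • S.M₂ k p.1.1

/-- The **cone tube** over the unit curve `k`: `t` times the radial projection of
`k θ + d₁ M₁ θ + d₂ M₂ θ` to the unit sphere — the cone over the tube of `k` in `𝕊³` with framing
`(M₁, M₂)` (cf. `IsNormalFraming.core`, `FramedTubularNbhd.lean`). [folklore] -/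
def coneTube (k : ℝ → 𝔼 4) (p : (ℝ × ℝ) × (ℝ × ℝ)) : 𝔼 4 :=
  p.1.2 • (‖S.coneAff k p‖⁻¹ • S.coneAff k p)

/-- The **tube of the strip**: the affine tube in the middle, blended by the time cut-offs into
the cone tubes over the two end knots near (and beyond) the ends. [folklore] -/
def tube (p : (ℝ × ℝ) × (ℝ × ℝ)) : 𝔼 4 :=
  (1 - S.χ₁ p.1.2 - S.χ₂ p.1.2) • S.affTube p + S.χ₁ p.1.2 • S.coneTube S.k₁ p
    + S.χ₂ p.1.2 • S.coneTube S.k₂ p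

/-! ### Smoothness -/

/-- The first normal field of the annulus is `C^∞`. [folklore] -/
theorem contDiff_n₁ : ContDiff ℝ ∞ S.n₁ := contDiff_frame₁ S.contDiff_F S.w
/-- The second normal field of the annulus is `C^∞`. [folklore] -/
theorem contDiff_n₂ : ContDiff ℝ ∞ S.n₂ := contDiff_frame₂ S.contDiff_F S.w

/-- The affine tube is `C^∞`. [folklore] -/
theorem contDiff_affTube : ContDiff ℝ ∞ S.affTube :=
  ((S.contDiff_F.comp contDiff_fst).add
    ((contDiff_fst.comp contDiff_snd).smul (S.contDiff_n₁.comp contDiff_fst))).add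
    ((contDiff_snd.comp contDiff_snd).smul (S.contDiff_n₂.comp contDiff_fst))

section ConeTube

variable {k : ℝ → 𝔼 4}

/-- The affine part of a cone tube is `C^∞`. [folklore] -/
theorem contDiff_coneAff (hk : ContDiff ℝ ∞ k) : ContDiff ℝ ∞ (S.coneAff k) :=
  ((hk.comp (contDiff_fst.comp contDiff_fst)).add
    ((contDiff_fst.comp contDiff_snd).smul
      ((S.contDiff_M₁ hk).comp (contDiff_fst.comp contDiff_fst)))).add
    ((contDiff_snd.comp contDiff_snd).smul
      ((S.contDiff_M₂ hk).comp (contDiff_fst.comp contDiff_fst)))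

/-- `‖k θ + d₁ M₁ θ + d₂ M₂ θ‖² = 1 + ‖d₁ M₁ θ + d₂ M₂ θ‖²` (`M₁, M₂ ⊥ k`, `‖k‖ = 1`). [folklore] -/
theorem norm_coneAff_sq (hn : ∀ θ, ‖k θ‖ = 1) (p : (ℝ × ℝ) × (ℝ × ℝ)) :
    ‖S.coneAff k p‖ ^ 2 = 1 + ‖p.2.1 • S.M₁ k p.1.1 + p.2.2 • S.M₂ k p.1.1‖ ^ 2 := by
  have horth : ⟪k p.1.1, p.2.1 • S.M₁ k p.1.1 + p.2.2 • S.M₂ k p.1.1⟫ = 0 := by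
    rw [inner_add_right, real_inner_smul_right, real_inner_smul_right,
      ← real_inner_comm (k p.1.1) (S.M₁ k p.1.1), ← real_inner_comm (k p.1.1) (S.M₂ k p.1.1),
      S.inner_M₁_self, S.inner_M₂_self, mul_zero, mul_zero, add_zero]
  unfold coneAff
  rw [add_assoc, norm_add_sq_real, horth, hn]
  ring

/-- The affine part of a cone tube has norm `≥ 1`, in particular it never vanishes. [folklore] -/
theorem one_le_norm_coneAff (hn : ∀ θ, ‖k θ‖ = 1) (p : (ℝ × ℝ) × (ℝ × ℝ)) :
    1 ≤ ‖S.coneAff k p‖ := by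
  have h := S.norm_coneAff_sq hn p
  nlinarith [norm_nonneg (S.coneAff k p),
    norm_nonneg (p.2.1 • S.M₁ k p.1.1 + p.2.2 • S.M₂ k p.1.1)]

/-- The affine part of a cone tube never vanishes. [folklore] -/
theorem coneAff_ne_zero (hn : ∀ θ, ‖k θ‖ = 1) (p : (ℝ × ℝ) × (ℝ × ℝ)) : S.coneAff k p ≠ 0 := by
  intro h
  have := S.one_le_norm_coneAff hn p
  rw [h, norm_zero] at this
  linarith

/-- The cone tube is `C^∞` (the denominator is `≥ 1`). [folklore] -/
theorem contDiff_coneTube (hk : ContDiff ℝ ∞ k) (hn : ∀ θ, ‖k θ‖ = 1) :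
    ContDiff ℝ ∞ (S.coneTube k) := by
  unfold coneTube
  refine (contDiff_snd.comp contDiff_fst).smul ?_
  exact ((S.contDiff_coneAff hk).norm ℝ fun p ↦ S.coneAff_ne_zero hn p).inv
    (fun p ↦ (norm_ne_zero_iff.2 (S.coneAff_ne_zero hn p))) |>.smul (S.contDiff_coneAff hk)

/-- The cone tube lies on the sphere of radius `|t|`. [folklore] -/
theorem norm_coneTube (hn : ∀ θ, ‖k θ‖ = 1) (p : (ℝ × ℝ) × (ℝ × ℝ)) :
    ‖S.coneTube k p‖ = |p.1.2| := by
  have h0 : ‖S.coneAff k p‖ ≠ 0 := norm_ne_zero_iff.2 (S.coneAff_ne_zero hn p)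
  unfold coneTube
  rw [norm_smul, norm_smul, norm_inv, norm_norm, inv_mul_cancel₀ h0, mul_one, Real.norm_eq_abs]

/-- On the zero section the cone tube is the cone: `coneTube k ((θ, t), 0) = t • k θ`. [folklore] -/
theorem coneTube_zero (hn : ∀ θ, ‖k θ‖ = 1) (q : ℝ × ℝ) : S.coneTube k (q, 0) = q.2 • k q.1 := by
  unfold coneTube coneAff
  simp [hn]

end ConeTube

/-- The tube is `C^∞`. [folklore] -/
theorem contDiff_tube : ContDiff ℝ ∞ S.tube := by
  unfold tube
  have ht : ContDiff ℝ ∞ fun p : (ℝ × ℝ) × (ℝ × ℝ) ↦ p.1.2 := contDiff_snd.comp contDiff_fst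
  refine ((((contDiff_const.sub (S.contDiff_χ₁.comp ht)).sub (S.contDiff_χ₂.comp ht)).smul
    S.contDiff_affTube).add ((S.contDiff_χ₁.comp ht).smul
      (S.contDiff_coneTube S.contDiff_k₁ S.norm_k₁))).add
    ((S.contDiff_χ₂.comp ht).smul (S.contDiff_coneTube S.contDiff_k₂ S.norm_k₂))

/-! ### Values on the zero section and near the ends -/

/-- On the zero section the affine tube is `F`. [folklore] -/
@[simp]
theorem affTube_zero (q : ℝ × ℝ) : S.affTube (q, 0) = S.F q := by
  simp [affTube]

/-- **On the zero section the tube is the annulus**: `tube (q, 0) = F q` (the cut-offs are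
supported in the cones, where `F` is the cone over `k₁` resp. `k₂`). [folklore] -/
theorem tube_zero (q : ℝ × ℝ) : S.tube (q, 0) = S.F q := by
  obtain ⟨θ, t⟩ := q
  unfold tube
  rw [affTube_zero, S.coneTube_zero S.norm_k₁, S.coneTube_zero S.norm_k₂]
  dsimp only
  by_cases h1 : S.χ₁ t = 0
  · by_cases h2 : S.χ₂ t = 0
    · rw [h1, h2]
      simp
    · have ht : 2 - S.δ ≤ t := by linarith [S.lt_of_χ₂_ne_zero h2, S.δ_pos]
      rw [h1, S.cone₂ θ t ht]
      module
  · have ht : t ≤ 1 + S.δ := by linarith [S.lt_of_χ₁_ne_zero h1, S.δ_pos]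
    have h2 : S.χ₂ t = 0 := S.χ₂_of_le (by linarith [S.δ_le])
    rw [h2, S.cone₁ θ t ht]
    module

/-- **Near and below the inner end the tube is the cone over the tube of `k₁`**:
for `t ≤ 1 + δ/4`, `tube ((θ, t), d) = coneTube k₁ ((θ, t), d)`. [folklore] -/
theorem tube_of_le {θ t : ℝ} (ht : t ≤ 1 + S.δ / 4) (d : ℝ × ℝ) :
    S.tube ((θ, t), d) = S.coneTube S.k₁ ((θ, t), d) := by
  unfold tube
  dsimp only
  rw [S.χ₁_of_le ht, S.χ₂_of_le (by linarith [S.δ_pos, S.δ_le])]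
  simp

/-- **Near and above the outer end the tube is the cone over the tube of `k₂`**:
for `t ≥ 2 - δ/4`, `tube ((θ, t), d) = coneTube k₂ ((θ, t), d)`. [folklore] -/
theorem tube_of_ge {θ t : ℝ} (ht : 2 - S.δ / 4 ≤ t) (d : ℝ × ℝ) :
    S.tube ((θ, t), d) = S.coneTube S.k₂ ((θ, t), d) := by
  unfold tube
  dsimp only
  rw [S.χ₂_of_ge ht, S.χ₁_of_ge (by linarith [S.δ_pos, S.δ_le])]
  simp

/-- Near the ends the tube lies on the sphere of radius `|t|` (level preserving). [folklore] -/
theorem norm_tube_of_le {θ t : ℝ} (ht : t ≤ 1 + S.δ / 4) (d : ℝ × ℝ) :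
    ‖S.tube ((θ, t), d)‖ = |t| := by
  rw [S.tube_of_le ht, S.norm_coneTube S.norm_k₁]

/-- Near the outer end the tube lies on the sphere of radius `|t|`. [folklore] -/
theorem norm_tube_of_ge {θ t : ℝ} (ht : 2 - S.δ / 4 ≤ t) (d : ℝ × ℝ) :
    ‖S.tube ((θ, t), d)‖ = |t| := by
  rw [S.tube_of_ge ht, S.norm_coneTube S.norm_k₂]

end TubeSetup

/-! ### Linear maps on `(ℝ × ℝ) × (ℝ × ℝ)` -/

/-- The continuous linear map `((v, e) ↦ A v + e₁ • a + e₂ • b)` on `(ℝ × ℝ) × (ℝ × ℝ)`: the shape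
of all the derivatives of tubes along the zero section. [folklore] -/
def mkL (A : ℝ × ℝ →L[ℝ] 𝔼 4) (a b : 𝔼 4) : (ℝ × ℝ) × (ℝ × ℝ) →L[ℝ] 𝔼 4 :=
  A.comp (ContinuousLinearMap.fst ℝ (ℝ × ℝ) (ℝ × ℝ))
    + ((ContinuousLinearMap.fst ℝ ℝ ℝ).comp (ContinuousLinearMap.snd ℝ (ℝ × ℝ) (ℝ × ℝ))).smulRight a
    + ((ContinuousLinearMap.snd ℝ ℝ ℝ).comp (ContinuousLinearMap.snd ℝ (ℝ × ℝ) (ℝ × ℝ))).smulRight b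

/-- Evaluation of `mkL`. [folklore] -/
@[simp]
theorem mkL_apply (A : ℝ × ℝ →L[ℝ] 𝔼 4) (a b : 𝔼 4) (p : (ℝ × ℝ) × (ℝ × ℝ)) :
    mkL A a b p = A p.1 + p.2.1 • a + p.2.2 • b := by
  simp [mkL]

/-- The derivative of the cone `(θ, t) ↦ t • k θ` at `q = (θ, t)`: `v ↦ v₂ • k θ + v₁ • (t • k' θ)`.
[folklore] -/
def coneL (k : ℝ → 𝔼 4) (q : ℝ × ℝ) : ℝ × ℝ →L[ℝ] 𝔼 4 :=
  (ContinuousLinearMap.snd ℝ ℝ ℝ).smulRight (k q.1)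
    + (ContinuousLinearMap.fst ℝ ℝ ℝ).smulRight (q.2 • deriv k q.1)

/-- Evaluation of `coneL`. [folklore] -/
@[simp]
theorem coneL_apply (k : ℝ → 𝔼 4) (q : ℝ × ℝ) (v : ℝ × ℝ) :
    coneL k q v = v.2 • k q.1 + v.1 • (q.2 • deriv k q.1) := by
  simp [coneL]

/-- The cone `(θ, t) ↦ t • k θ` has derivative `coneL k q` at `q`. [folklore] -/
theorem hasFDerivAt_cone {k : ℝ → 𝔼 4} (hk : ContDiff ℝ ∞ k) (q : ℝ × ℝ) :
    HasFDerivAt (fun q : ℝ × ℝ ↦ q.2 • k q.1) (coneL k q) q := by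
  have hkd : HasFDerivAt (fun q : ℝ × ℝ ↦ k q.1)
      (((1 : ℝ →L[ℝ] ℝ).smulRight (deriv k q.1)).comp (ContinuousLinearMap.fst ℝ ℝ ℝ)) q :=
    ((hk.differentiable (by simp)) q.1).hasDerivAt.hasFDerivAt.comp q hasFDerivAt_fst
  have h := (hasFDerivAt_snd (𝕜 := ℝ) (E := ℝ) (F := ℝ) (p := q)).smul hkd
  refine h.congr_fderiv ?_
  ext v <;> simp [smul_smul, mul_comm]

/-! ### The derivative of the normalisation `y ↦ y / ‖y‖` at a unit vector -/

/-- At a unit vector `y₀`, the radial projection `y ↦ ‖y‖⁻¹ • y` has derivative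
`w ↦ w - ⟪y₀, w⟫ y₀` (the orthogonal projection to `y₀ᗮ`). [folklore] -/
theorem hasFDerivAt_normalize {y₀ : 𝔼 4} (h : ‖y₀‖ = 1) :
    HasFDerivAt (fun y : 𝔼 4 ↦ ‖y‖⁻¹ • y)
      (ContinuousLinearMap.id ℝ (𝔼 4) - (innerSL ℝ y₀).smulRight y₀) y₀ := by
  -- the squared norm
  have hsq : HasFDerivAt (fun y : 𝔼 4 ↦ ‖y‖ ^ 2) (2 • innerSL ℝ y₀) y₀ :=
    (hasStrictFDerivAt_norm_sq y₀).hasFDerivAt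
  -- the inverse norm `(√(‖y‖²))⁻¹`
  have hφ : HasDerivAt (fun s : ℝ ↦ (Real.sqrt s)⁻¹)
      (-(1 / (2 * Real.sqrt 1)) / (Real.sqrt 1) ^ 2) (‖y₀‖ ^ 2) := by
    rw [h, one_pow]
    exact (Real.hasDerivAt_sqrt one_ne_zero).inv (by simp)
  have hinv := hφ.comp_hasFDerivAt y₀ hsq
  have hfun : ((fun s : ℝ ↦ (Real.sqrt s)⁻¹) ∘ fun y : 𝔼 4 ↦ ‖y‖ ^ 2) = fun y ↦ ‖y‖⁻¹ := by
    funext y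
    simp [Real.sqrt_sq (norm_nonneg _)]
  rw [hfun] at hinv
  have hinv' : HasFDerivAt (fun y : 𝔼 4 ↦ ‖y‖⁻¹) (-(innerSL ℝ y₀ : 𝔼 4 →L[ℝ] ℝ)) y₀ := by
    refine hinv.congr_fderiv (ContinuousLinearMap.ext fun w ↦ ?_)
    simp
  have := hinv'.smul (hasFDerivAt_id y₀)
  rw [h, inv_one] at this
  refine this.congr_fderiv (ContinuousLinearMap.ext fun w ↦ ?_)
  simp [sub_eq_add_neg]

namespace TubeSetup

variable (S : TubeSetup)

/-! ### The derivative of the affine tube and of the cone tubes along the zero section -/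

/-- **Derivative of the affine tube on the zero section**: `(v, e) ↦ DF(q) v + e₁ n₁ q + e₂ n₂ q`.
[folklore] -/
theorem hasFDerivAt_affTube (q : ℝ × ℝ) :
    HasFDerivAt S.affTube (mkL (fderiv ℝ S.F q) (S.n₁ q) (S.n₂ q)) (q, 0) := by
  set p₀ : (ℝ × ℝ) × (ℝ × ℝ) := (q, 0) with hp₀
  have hfst : HasFDerivAt (Prod.fst : (ℝ × ℝ) × (ℝ × ℝ) → ℝ × ℝ)
      (ContinuousLinearMap.fst ℝ (ℝ × ℝ) (ℝ × ℝ)) p₀ := hasFDerivAt_fst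
  have hF : HasFDerivAt (S.F ∘ (Prod.fst : (ℝ × ℝ) × (ℝ × ℝ) → ℝ × ℝ))
      ((fderiv ℝ S.F q).comp (ContinuousLinearMap.fst ℝ (ℝ × ℝ) (ℝ × ℝ))) p₀ :=
    ((S.contDiff_F.differentiable (by simp)) q).hasFDerivAt.comp p₀ hfst
  have h1 : HasFDerivAt (S.n₁ ∘ (Prod.fst : (ℝ × ℝ) × (ℝ × ℝ) → ℝ × ℝ))
      ((fderiv ℝ S.n₁ q).comp (ContinuousLinearMap.fst ℝ (ℝ × ℝ) (ℝ × ℝ))) p₀ :=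
    ((S.contDiff_n₁.differentiable (by simp)) q).hasFDerivAt.comp p₀ hfst
  have h2 : HasFDerivAt (S.n₂ ∘ (Prod.fst : (ℝ × ℝ) × (ℝ × ℝ) → ℝ × ℝ))
      ((fderiv ℝ S.n₂ q).comp (ContinuousLinearMap.fst ℝ (ℝ × ℝ) (ℝ × ℝ))) p₀ :=
    ((S.contDiff_n₂.differentiable (by simp)) q).hasFDerivAt.comp p₀ hfst
  have hc1 : HasFDerivAt (fun p : (ℝ × ℝ) × (ℝ × ℝ) ↦ p.2.1)
      ((ContinuousLinearMap.fst ℝ ℝ ℝ).comp (ContinuousLinearMap.snd ℝ (ℝ × ℝ) (ℝ × ℝ))) p₀ :=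
    hasFDerivAt_fst.comp p₀ hasFDerivAt_snd
  have hc2 : HasFDerivAt (fun p : (ℝ × ℝ) × (ℝ × ℝ) ↦ p.2.2)
      ((ContinuousLinearMap.snd ℝ ℝ ℝ).comp (ContinuousLinearMap.snd ℝ (ℝ × ℝ) (ℝ × ℝ))) p₀ :=
    hasFDerivAt_snd.comp p₀ hasFDerivAt_snd
  have h := (hF.add (hc1.smul h1)).add (hc2.smul h2)
  refine h.congr_fderiv ?_
  ext v <;> simp [mkL, hp₀]

section ConeDeriv

variable {k : ℝ → 𝔼 4}

/-- Derivative of the affine part of a cone tube on the zero section: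
`(v, e) ↦ v₁ • k' θ + e₁ M₁ θ + e₂ M₂ θ`. [folklore] -/
theorem hasFDerivAt_coneAff (hk : ContDiff ℝ ∞ k) (q : ℝ × ℝ) :
    HasFDerivAt (S.coneAff k)
      (mkL ((ContinuousLinearMap.fst ℝ ℝ ℝ).smulRight (deriv k q.1)) (S.M₁ k q.1) (S.M₂ k q.1))
      (q, 0) := by
  set p₀ : (ℝ × ℝ) × (ℝ × ℝ) := (q, 0) with hp₀
  set π : (ℝ × ℝ) × (ℝ × ℝ) → ℝ := fun p ↦ p.1.1 with hπ
  have hθ : HasFDerivAt π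
      ((ContinuousLinearMap.fst ℝ ℝ ℝ).comp (ContinuousLinearMap.fst ℝ (ℝ × ℝ) (ℝ × ℝ))) p₀ :=
    hasFDerivAt_fst.comp p₀ hasFDerivAt_fst
  have hkd : HasFDerivAt (k ∘ π)
      (((1 : ℝ →L[ℝ] ℝ).smulRight (deriv k q.1)).comp
        ((ContinuousLinearMap.fst ℝ ℝ ℝ).comp (ContinuousLinearMap.fst ℝ (ℝ × ℝ) (ℝ × ℝ)))) p₀ :=
    ((hk.differentiable (by simp)) q.1).hasDerivAt.hasFDerivAt.comp p₀ hθ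
  have h1 : HasFDerivAt (S.M₁ k ∘ π)
      ((fderiv ℝ (S.M₁ k) q.1).comp
        ((ContinuousLinearMap.fst ℝ ℝ ℝ).comp (ContinuousLinearMap.fst ℝ (ℝ × ℝ) (ℝ × ℝ)))) p₀ :=
    (((S.contDiff_M₁ hk).differentiable (by simp)) q.1).hasFDerivAt.comp p₀ hθ
  have h2 : HasFDerivAt (S.M₂ k ∘ π)
      ((fderiv ℝ (S.M₂ k) q.1).comp
        ((ContinuousLinearMap.fst ℝ ℝ ℝ).comp (ContinuousLinearMap.fst ℝ (ℝ × ℝ) (ℝ × ℝ)))) p₀ :=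
    (((S.contDiff_M₂ hk).differentiable (by simp)) q.1).hasFDerivAt.comp p₀ hθ
  have hc1 : HasFDerivAt (fun p : (ℝ × ℝ) × (ℝ × ℝ) ↦ p.2.1)
      ((ContinuousLinearMap.fst ℝ ℝ ℝ).comp (ContinuousLinearMap.snd ℝ (ℝ × ℝ) (ℝ × ℝ))) p₀ :=
    hasFDerivAt_fst.comp p₀ hasFDerivAt_snd
  have hc2 : HasFDerivAt (fun p : (ℝ × ℝ) × (ℝ × ℝ) ↦ p.2.2)
      ((ContinuousLinearMap.snd ℝ ℝ ℝ).comp (ContinuousLinearMap.snd ℝ (ℝ × ℝ) (ℝ × ℝ))) p₀ :=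
    hasFDerivAt_snd.comp p₀ hasFDerivAt_snd
  have h := (hkd.add (hc1.smul h1)).add (hc2.smul h2)
  refine h.congr_fderiv ?_
  ext v <;> simp [mkL, hp₀, hπ]

/-- **Derivative of the radially projected affine part on the zero section**: the same map
`(v, e) ↦ v₁ • k' θ + e₁ M₁ θ + e₂ M₂ θ` — its values are orthogonal to `k θ`, on which the
derivative of the radial projection is the identity. [folklore] -/
theorem hasFDerivAt_normalize_coneAff (hk : ContDiff ℝ ∞ k) (hn : ∀ θ, ‖k θ‖ = 1) (q : ℝ × ℝ) :
    HasFDerivAt (fun p ↦ ‖S.coneAff k p‖⁻¹ • S.coneAff k p)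
      (mkL ((ContinuousLinearMap.fst ℝ ℝ ℝ).smulRight (deriv k q.1)) (S.M₁ k q.1) (S.M₂ k q.1))
      (q, 0) := by
  have h0 : S.coneAff k (q, 0) = k q.1 := by simp [coneAff]
  have hN := hasFDerivAt_normalize (hn q.1)
  rw [← h0] at hN
  have h := hN.comp (q, 0) (S.hasFDerivAt_coneAff hk q)
  refine h.congr_fderiv ?_
  have hk' : ⟪k q.1, deriv k q.1⟫ = 0 :=
    inner_deriv_eq_zero_of_norm_eq_one (hk.differentiable (by simp)) hn q.1
  have hm1 : ⟪k q.1, S.M₁ k q.1⟫ = 0 := by rw [real_inner_comm]; exact S.inner_M₁_self q.1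
  have hm2 : ⟪k q.1, S.M₂ k q.1⟫ = 0 := by rw [real_inner_comm]; exact S.inner_M₂_self q.1
  ext v <;> simp [mkL, h0, hk', hm1, hm2]

/-- **Derivative of a cone tube on the zero section**:
`(v, e) ↦ v₂ • k θ + v₁ • (t • k' θ) + e₁ (t • M₁ θ) + e₂ (t • M₂ θ)`. [folklore] -/
theorem hasFDerivAt_coneTube (hk : ContDiff ℝ ∞ k) (hn : ∀ θ, ‖k θ‖ = 1) (q : ℝ × ℝ) :
    HasFDerivAt (S.coneTube k)
      (mkL (coneL k q) (q.2 • S.M₁ k q.1) (q.2 • S.M₂ k q.1)) (q, 0) := by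
  have h0 : ‖S.coneAff k (q, 0)‖⁻¹ • S.coneAff k (q, 0) = k q.1 := by simp [coneAff, hn]
  have ht : HasFDerivAt (fun p : (ℝ × ℝ) × (ℝ × ℝ) ↦ p.1.2)
      ((ContinuousLinearMap.snd ℝ ℝ ℝ).comp (ContinuousLinearMap.fst ℝ (ℝ × ℝ) (ℝ × ℝ))) (q, 0) :=
    hasFDerivAt_snd.comp (q, 0) hasFDerivAt_fst
  have h := ht.smul (S.hasFDerivAt_normalize_coneAff hk hn q)
  rw [h0] at h
  refine h.congr_fderiv ?_
  ext v <;> simp [mkL, smul_smul, mul_comm]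

end ConeDeriv

/-! ### The annulus on the cone zones -/

/-- On the open inner cone zone, `DF = D(t • k₁ θ)`. [folklore] -/
theorem fderiv_F_of_lt {q : ℝ × ℝ} (hq : q.2 < 1 + S.δ) : fderiv ℝ S.F q = coneL S.k₁ q := by
  have hev : S.F =ᶠ[𝓝 q] fun q : ℝ × ℝ ↦ q.2 • S.k₁ q.1 := by
    have hO : IsOpen {q : ℝ × ℝ | q.2 < 1 + S.δ} := isOpen_lt continuous_snd continuous_const
    filter_upwards [hO.mem_nhds hq] with r hr
    exact S.cone₁ r.1 r.2 (le_of_lt hr)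
  exact ((hasFDerivAt_cone S.contDiff_k₁ q).congr_of_eventuallyEq hev).fderiv

/-- On the open outer cone zone, `DF = D(t • k₂ θ)`. [folklore] -/
theorem fderiv_F_of_gt {q : ℝ × ℝ} (hq : 2 - S.δ < q.2) : fderiv ℝ S.F q = coneL S.k₂ q := by
  have hev : S.F =ᶠ[𝓝 q] fun q : ℝ × ℝ ↦ q.2 • S.k₂ q.1 := by
    have hO : IsOpen {q : ℝ × ℝ | 2 - S.δ < q.2} := isOpen_lt continuous_const continuous_snd
    filter_upwards [hO.mem_nhds hq] with r hr
    exact S.cone₂ r.1 r.2 (le_of_lt hr)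
  exact ((hasFDerivAt_cone S.contDiff_k₂ q).congr_of_eventuallyEq hev).fderiv

/-- On a cone zone the partial derivatives of `F` are `t • k' θ` and `k θ`. [folklore] -/
theorem dθ_dt_of_fderiv_eq {k : ℝ → 𝔼 4} {q : ℝ × ℝ} (h : fderiv ℝ S.F q = coneL k q) :
    dθ S.F q = q.2 • deriv k q.1 ∧ dt S.F q = k q.1 := by
  constructor
  · show fderiv ℝ S.F q (1, 0) = _
    rw [h, coneL_apply]
    simp
  · show fderiv ℝ S.F q (0, 1) = _
    rw [h, coneL_apply]
    simp

/-- On a cone zone the normal frame of the annulus is `(t² M₁, t³ M₂)` (homogeneity of the normal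
part and of the triple cross product). [folklore] -/
theorem n₁_n₂_of_fderiv_eq {k : ℝ → 𝔼 4} {q : ℝ × ℝ} (h : fderiv ℝ S.F q = coneL k q) :
    S.n₁ q = (q.2 * q.2) • S.M₁ k q.1 ∧ S.n₂ q = (q.2 * (q.2 * q.2)) • S.M₂ k q.1 := by
  obtain ⟨h1, h2⟩ := S.dθ_dt_of_fderiv_eq h
  have e1 : S.n₁ q = (q.2 * q.2) • S.M₁ k q.1 := by
    show frame₁ S.F S.w q = _
    unfold frame₁ M₁
    rw [h1, h2, normalPart_smul_left]
  refine ⟨e1, ?_⟩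
  show frame₂ S.F S.w q = _
  unfold frame₂ M₂
  rw [show frame₁ S.F S.w q = S.n₁ q from rfl, e1, h1, h2, triCross_smul_left_right]

/-- The inner cut-off has vanishing derivative past its support. [folklore] -/
theorem deriv_χ₁_of_gt {t : ℝ} (ht : 1 + S.δ / 2 < t) : deriv S.χ₁ t = 0 := by
  have hev : S.χ₁ =ᶠ[𝓝 t] fun _ ↦ 0 := by
    filter_upwards [Ioi_mem_nhds ht] with s hs using S.χ₁_of_ge (le_of_lt hs)
  rw [hev.deriv_eq, deriv_const]

/-- The outer cut-off has vanishing derivative before its support. [folklore] -/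
theorem deriv_χ₂_of_lt {t : ℝ} (ht : t < 2 - S.δ / 2) : deriv S.χ₂ t = 0 := by
  have hev : S.χ₂ =ᶠ[𝓝 t] fun _ ↦ 0 := by
    filter_upwards [Iio_mem_nhds ht] with s hs using S.χ₂_of_le (le_of_lt hs)
  rw [hev.deriv_eq, deriv_const]

/-! ### The derivative of the tube along the zero section -/

/-- The projection `p ↦ t` as a continuous linear map on `(ℝ × ℝ) × (ℝ × ℝ)`. [folklore] -/
abbrev timeL : (ℝ × ℝ) × (ℝ × ℝ) →L[ℝ] ℝ :=
  (ContinuousLinearMap.snd ℝ ℝ ℝ).comp (ContinuousLinearMap.fst ℝ (ℝ × ℝ) (ℝ × ℝ))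

/-- **The raw derivative of the tube at `(q, 0)`** (product rule applied to the blend; no cone
hypothesis used). [folklore] -/
def tubeDerivRaw (q : ℝ × ℝ) : (ℝ × ℝ) × (ℝ × ℝ) →L[ℝ] 𝔼 4 :=
  (1 - S.χ₁ q.2 - S.χ₂ q.2) • mkL (fderiv ℝ S.F q) (S.n₁ q) (S.n₂ q)
    + S.χ₁ q.2 • mkL (coneL S.k₁ q) (q.2 • S.M₁ S.k₁ q.1) (q.2 • S.M₂ S.k₁ q.1)
    + S.χ₂ q.2 • mkL (coneL S.k₂ q) (q.2 • S.M₁ S.k₂ q.1) (q.2 • S.M₂ S.k₂ q.1)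
    + timeL.smulRight ((-deriv S.χ₁ q.2 - deriv S.χ₂ q.2) • S.F q
        + deriv S.χ₁ q.2 • (q.2 • S.k₁ q.1) + deriv S.χ₂ q.2 • (q.2 • S.k₂ q.1))

/-- **The tube has the raw derivative at every point of the zero section.** [folklore] -/
theorem hasFDerivAt_tube_raw (q : ℝ × ℝ) : HasFDerivAt S.tube (S.tubeDerivRaw q) (q, 0) := by
  set p₀ : (ℝ × ℝ) × (ℝ × ℝ) := (q, 0) with hp₀
  have ht : HasFDerivAt (fun p : (ℝ × ℝ) × (ℝ × ℝ) ↦ p.1.2) timeL p₀ :=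
    hasFDerivAt_snd.comp p₀ hasFDerivAt_fst
  have hd : ∀ {G : ℝ → ℝ}, ContDiff ℝ ∞ G → HasFDerivAt (fun p : (ℝ × ℝ) × (ℝ × ℝ) ↦ G p.1.2)
      (((1 : ℝ →L[ℝ] ℝ).smulRight (deriv G q.2)).comp timeL) p₀ := fun hG ↦
    ((hG.differentiable (by simp)) q.2).hasDerivAt.hasFDerivAt.comp p₀ ht
  have hG₀ : HasFDerivAt (fun p : (ℝ × ℝ) × (ℝ × ℝ) ↦ 1 - S.χ₁ p.1.2 - S.χ₂ p.1.2)
      (0 - ((1 : ℝ →L[ℝ] ℝ).smulRight (deriv S.χ₁ q.2)).comp timeL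
        - ((1 : ℝ →L[ℝ] ℝ).smulRight (deriv S.χ₂ q.2)).comp timeL) p₀ :=
    ((hasFDerivAt_const (1 : ℝ) p₀).sub (hd S.contDiff_χ₁)).sub (hd S.contDiff_χ₂)
  have h := ((hG₀.smul (S.hasFDerivAt_affTube q)).add
    ((hd S.contDiff_χ₁).smul (S.hasFDerivAt_coneTube S.contDiff_k₁ S.norm_k₁ q))).add
    ((hd S.contDiff_χ₂).smul (S.hasFDerivAt_coneTube S.contDiff_k₂ S.norm_k₂ q))
  have h0a : S.affTube p₀ = S.F q := S.affTube_zero q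
  have h0b : S.coneTube S.k₁ p₀ = q.2 • S.k₁ q.1 := S.coneTube_zero S.norm_k₁ q
  have h0c : S.coneTube S.k₂ p₀ = q.2 • S.k₂ q.1 := S.coneTube_zero S.norm_k₂ q
  rw [h0a, h0b, h0c] at h
  refine h.congr_fderiv (ContinuousLinearMap.ext fun v ↦ ?_)
  simp [tubeDerivRaw, hp₀]
  module

/-- The first normal field of the tube along the zero section (blend of `n₁` and the cone
frames). [folklore] -/
def V₁ (q : ℝ × ℝ) : 𝔼 4 :=
  (1 - S.χ₁ q.2 - S.χ₂ q.2) • S.n₁ q + S.χ₁ q.2 • (q.2 • S.M₁ S.k₁ q.1)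
    + S.χ₂ q.2 • (q.2 • S.M₁ S.k₂ q.1)

/-- The second normal field of the tube along the zero section. [folklore] -/
def V₂ (q : ℝ × ℝ) : 𝔼 4 :=
  (1 - S.χ₁ q.2 - S.χ₂ q.2) • S.n₂ q + S.χ₁ q.2 • (q.2 • S.M₂ S.k₁ q.1)
    + S.χ₂ q.2 • (q.2 • S.M₂ S.k₂ q.1)

/-- **The derivative of the tube at `(q, 0)`**: `(v, e) ↦ DF(q) v + e₁ V₁ q + e₂ V₂ q`. [folklore] -/
def tubeDeriv (q : ℝ × ℝ) : (ℝ × ℝ) × (ℝ × ℝ) →L[ℝ] 𝔼 4 :=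
  mkL (fderiv ℝ S.F q) (S.V₁ q) (S.V₂ q)

/-- The raw derivative is the clean one (the cut-offs live in the cones, where `F` is the cone
and the correction terms cancel). [folklore] -/
theorem tubeDerivRaw_eq (q : ℝ × ℝ) : S.tubeDerivRaw q = S.tubeDeriv q := by
  obtain ⟨θ, t⟩ := q
  refine ContinuousLinearMap.ext fun v ↦ ?_
  simp only [tubeDerivRaw, tubeDeriv, V₁, V₂, mkL_apply, add_apply, smul_apply,
    ContinuousLinearMap.smulRight_apply, ContinuousLinearMap.comp_apply,
    ContinuousLinearMap.coe_snd', ContinuousLinearMap.coe_fst']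
  -- three overlapping open cases in `t`
  rcases lt_or_ge t (1 + S.δ) with h1 | h1
  · -- inner cone zone
    have hF : S.F (θ, t) = t • S.k₁ θ := S.cone₁ θ t h1.le
    have hD : fderiv ℝ S.F (θ, t) = coneL S.k₁ (θ, t) := S.fderiv_F_of_lt h1
    have hχ₂ : S.χ₂ t = 0 := S.χ₂_of_le (by linarith [S.δ_le, S.δ_pos])
    have hχ₂' : deriv S.χ₂ t = 0 := S.deriv_χ₂_of_lt (by linarith [S.δ_le, S.δ_pos])
    rw [hF, hD, hχ₂, hχ₂']
    module
  rcases lt_or_ge (2 - S.δ) t with h2 | h2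
  · -- outer cone zone
    have hF : S.F (θ, t) = t • S.k₂ θ := S.cone₂ θ t h2.le
    have hD : fderiv ℝ S.F (θ, t) = coneL S.k₂ (θ, t) := S.fderiv_F_of_gt h2
    have hχ₁ : S.χ₁ t = 0 := S.χ₁_of_ge (by linarith [S.δ_le, S.δ_pos])
    have hχ₁' : deriv S.χ₁ t = 0 := S.deriv_χ₁_of_gt (by linarith [S.δ_le, S.δ_pos])
    rw [hF, hD, hχ₁, hχ₁']
    module
  · -- the middle: both cut-offs vanish near `t`
    have hχ₁ : S.χ₁ t = 0 := S.χ₁_of_ge (by linarith [S.δ_pos])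
    have hχ₁' : deriv S.χ₁ t = 0 := S.deriv_χ₁_of_gt (by linarith [S.δ_pos])
    have hχ₂ : S.χ₂ t = 0 := S.χ₂_of_le (by linarith [S.δ_pos])
    have hχ₂' : deriv S.χ₂ t = 0 := S.deriv_χ₂_of_lt (by linarith [S.δ_pos])
    rw [hχ₁, hχ₁', hχ₂, hχ₂']
    module

/-- **The tube has derivative `tubeDeriv q` at `(q, 0)`.** [folklore] -/
theorem hasFDerivAt_tube (q : ℝ × ℝ) : HasFDerivAt S.tube (S.tubeDeriv q) (q, 0) :=
  S.tubeDerivRaw_eq q ▸ S.hasFDerivAt_tube_raw q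

/-- Positivity of the blending coefficients `1 - χ + χ a` for `0 ≤ χ ≤ 1`, `a > 0`. [folklore] -/
theorem _root_.Literature.Topology.FourManifolds.StripFrame.blend_pos {a χ : ℝ} (ha : 0 < a)
    (h0 : 0 ≤ χ) (h1 : χ ≤ 1) : 0 < 1 - χ + χ * a := by
  rcases eq_or_lt_of_le h0 with h | h
  · rw [← h]
    norm_num
  · nlinarith [mul_pos h ha]

/-- **The normal fields of the tube are positive multiples of the normal frame of the annulus**
(for `t > 0`): in the middle they coincide; on the cone zones `n₁ = t² M₁`, `n₂ = t³ M₂`. [folklore] -/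
theorem exists_V_eq_smul {q : ℝ × ℝ} (ht : 0 < q.2) :
    ∃ ρ₁ ρ₂ : ℝ, 0 < ρ₁ ∧ 0 < ρ₂ ∧ S.V₁ q = ρ₁ • S.n₁ q ∧ S.V₂ q = ρ₂ • S.n₂ q := by
  obtain ⟨θ, t⟩ := q
  simp only at ht
  have hχ₁0 := S.χ₁_nonneg t
  have hχ₁1 := S.χ₁_le_one t
  have hχ₂0 := S.χ₂_nonneg t
  have hχ₂1 := S.χ₂_le_one t
  rcases lt_or_ge t (1 + S.δ) with h1 | h1
  · have hχ₂ : S.χ₂ t = 0 := S.χ₂_of_le (by linarith [S.δ_le, S.δ_pos])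
    obtain ⟨e1, e2⟩ := S.n₁_n₂_of_fderiv_eq (S.fderiv_F_of_lt (q := (θ, t)) h1)
    simp only at e1 e2
    refine ⟨1 - S.χ₁ t + S.χ₁ t * t⁻¹, 1 - S.χ₁ t + S.χ₁ t * (t * t)⁻¹,
      blend_pos (inv_pos.2 ht) hχ₁0 hχ₁1,
      blend_pos (inv_pos.2 (mul_pos ht ht)) hχ₁0 hχ₁1, ?_, ?_⟩
    · simp only [V₁, hχ₂, e1, smul_smul, sub_zero, zero_mul, zero_smul, add_zero]
      rw [← add_smul]
      congr 1
      field_simp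
    · simp only [V₂, hχ₂, e2, smul_smul, sub_zero, zero_mul, zero_smul, add_zero]
      rw [← add_smul]
      congr 1
      field_simp
  rcases lt_or_ge (2 - S.δ) t with h2 | h2
  · have hχ₁ : S.χ₁ t = 0 := S.χ₁_of_ge (by linarith [S.δ_le, S.δ_pos])
    obtain ⟨e1, e2⟩ := S.n₁_n₂_of_fderiv_eq (S.fderiv_F_of_gt (q := (θ, t)) h2)
    simp only at e1 e2
    refine ⟨1 - S.χ₂ t + S.χ₂ t * t⁻¹, 1 - S.χ₂ t + S.χ₂ t * (t * t)⁻¹,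
      blend_pos (inv_pos.2 ht) hχ₂0 hχ₂1,
      blend_pos (inv_pos.2 (mul_pos ht ht)) hχ₂0 hχ₂1, ?_, ?_⟩
    · simp only [V₁, hχ₁, e1, smul_smul, sub_zero, zero_mul, zero_smul, add_zero]
      rw [← add_smul]
      congr 1
      field_simp
    · simp only [V₂, hχ₁, e2, smul_smul, sub_zero, zero_mul, zero_smul, add_zero]
      rw [← add_smul]
      congr 1
      field_simp
  · have hχ₁ : S.χ₁ t = 0 := S.χ₁_of_ge (by linarith [S.δ_pos])
    have hχ₂ : S.χ₂ t = 0 := S.χ₂_of_le (by linarith [S.δ_pos])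
    refine ⟨1, 1, one_pos, one_pos, ?_, ?_⟩
    · simp [V₁, hχ₁, hχ₂]
    · simp [V₂, hχ₁, hχ₂]

/-- **The derivative of the tube along the framed strip is injective**: at a point `q = (θ, t)`
with `t > 0` where `F` is an immersion (`gramD ≠ 0`) and the first normal field does not vanish,
`tubeDeriv q` has trivial kernel. [folklore] -/
theorem injective_tubeDeriv {q : ℝ × ℝ} (ht : 0 < q.2) (hD : gramD S.F q ≠ 0)
    (h₁ : S.n₁ q ≠ 0) : Injective (S.tubeDeriv q) := by
  obtain ⟨ρ₁, ρ₂, hρ₁, hρ₂, e1, e2⟩ := S.exists_V_eq_smul ht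
  refine (injective_iff_map_eq_zero _).2 fun p hp ↦ ?_
  obtain ⟨v, e⟩ := p
  have hp' : v.1 • dθ S.F q + v.2 • dt S.F q + (e.1 * ρ₁) • S.n₁ q + (e.2 * ρ₂) • S.n₂ q = 0 := by
    rw [tubeDeriv, mkL_apply, fderiv_apply_eq, e1, e2, smul_smul, smul_smul] at hp
    exact hp
  obtain ⟨ha, hb, hc, hd⟩ := eq_zero_of_combination_eq_zero hD h₁ hp'
  have hc' : e.1 = 0 := (mul_eq_zero.1 hc).resolve_right hρ₁.ne'
  have hd' : e.2 = 0 := (mul_eq_zero.1 hd).resolve_right hρ₂.ne'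
  exact Prod.ext (Prod.ext ha hb) (Prod.ext hc' hd')

/-! ### Local and uniform injectivity of the tube -/

/-- `dim ((ℝ × ℝ) × (ℝ × ℝ)) = dim ℝ⁴`. [folklore] -/
theorem finrank_domain_eq :
    Module.finrank ℝ ((ℝ × ℝ) × (ℝ × ℝ)) = Module.finrank ℝ (𝔼 4) := by
  simp [Module.finrank_prod]

/-- **The tube is locally injective at the framed points of the zero section** (inverse function
theorem: its derivative there is a linear isomorphism). [folklore] -/
theorem exists_nhds_injOn {q : ℝ × ℝ} (ht : 0 < q.2) (hD : gramD S.F q ≠ 0) (h₁ : S.n₁ q ≠ 0) :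
    ∃ U ∈ 𝓝 ((q, 0) : (ℝ × ℝ) × (ℝ × ℝ)), InjOn S.tube U := by
  have hinj := S.injective_tubeDeriv ht hD h₁
  set L : ((ℝ × ℝ) × (ℝ × ℝ)) ≃L[ℝ] 𝔼 4 :=
    (LinearMap.linearEquivOfInjective (S.tubeDeriv q).toLinearMap hinj
      finrank_domain_eq).toContinuousLinearEquiv with hL
  have hLe : (L : ((ℝ × ℝ) × (ℝ × ℝ)) →L[ℝ] 𝔼 4) = S.tubeDeriv q := by
    refine ContinuousLinearMap.ext fun v ↦ ?_
    simp [hL]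
  have hstrict : HasStrictFDerivAt S.tube (L : ((ℝ × ℝ) × (ℝ × ℝ)) →L[ℝ] 𝔼 4) (q, 0) := by
    rw [hLe]
    exact S.contDiff_tube.contDiffAt.hasStrictFDerivAt' (S.hasFDerivAt_tube q) (by simp)
  exact ⟨(HasStrictFDerivAt.toOpenPartialHomeomorph S.tube hstrict).source,
    (HasStrictFDerivAt.toOpenPartialHomeomorph S.tube hstrict).open_source.mem_nhds
      (HasStrictFDerivAt.mem_toOpenPartialHomeomorph_source hstrict),
    (HasStrictFDerivAt.toOpenPartialHomeomorph S.tube hstrict).injOn⟩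

/-- The derivative of the tube is a continuous function of the point. [folklore] -/
theorem continuous_fderiv_tube : Continuous (fderiv ℝ S.tube) :=
  S.contDiff_tube.continuous_fderiv (by simp)

/-- The points where the derivative of the tube is injective form an open set
(`ContinuousLinearMap.isOpen_injective`). [folklore] -/
theorem isOpen_setOf_injective_fderiv :
    IsOpen {p : (ℝ × ℝ) × (ℝ × ℝ) | Injective (fderiv ℝ S.tube p)} :=
  ContinuousLinearMap.isOpen_injective.preimage S.continuous_fderiv_tube

/-- At the framed points of the zero section the derivative of the tube is injective. [folklore] -/
theorem injective_fderiv_tube_zero {q : ℝ × ℝ} (ht : 0 < q.2) (hD : gramD S.F q ≠ 0)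
    (h₁ : S.n₁ q ≠ 0) : Injective (fderiv ℝ S.tube (q, 0)) := by
  rw [(S.hasFDerivAt_tube q).fderiv]
  exact S.injective_tubeDeriv ht hD h₁

/-- **A uniform injective tube around a compact framed strip.** Let `T ⊆ ℝ × ℝ` be compact with
`t > 0`, `F` an immersion and `n₁ ≠ 0` on `T`, and `F` injective on `T`. Then for some `ε > 0`
the tube is injective, with injective derivative, on `T × B(0, ε)`: injectivity spreads from the
compact zero section, where the tube is the injective map `F` and is locally injective
(`exists_isOpen_injOn_of_isCompact`, `StraightLineIsotopyExtension.lean`; Hirsch (1976), Ch. 4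
§5, Ex. 5), and the width is made uniform by the tube lemma. [folklore] -/
theorem exists_injOn_tube {T : Set (ℝ × ℝ)} (hT : IsCompact T) (hpos : ∀ q ∈ T, 0 < q.2)
    (hgood : ∀ q ∈ T, gramD S.F q ≠ 0 ∧ S.n₁ q ≠ 0) (hinjF : InjOn S.F T) :
    ∃ ε : ℝ, 0 < ε ∧ InjOn S.tube (T ×ˢ Metric.ball (0 : ℝ × ℝ) ε) ∧
      ∀ p ∈ T ×ˢ Metric.ball (0 : ℝ × ℝ) ε, Injective (fderiv ℝ S.tube p) := by
  set K : Set ((ℝ × ℝ) × (ℝ × ℝ)) := T ×ˢ {0} with hK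
  have hKc : IsCompact K := hT.prod isCompact_singleton
  -- injectivity on the zero section
  have hinjK : InjOn S.tube K := by
    rintro ⟨q, d⟩ ⟨hq, hd⟩ ⟨q', d'⟩ ⟨hq', hd'⟩ h
    rw [mem_singleton_iff] at hd hd'
    subst hd hd'
    rw [S.tube_zero, S.tube_zero] at h
    have e : q = q' := hinjF hq hq' h
    rw [e]
  -- local injectivity at the points of the zero section
  have hloc : ∀ p ∈ K, ∃ U ∈ 𝓝 p, InjOn S.tube U := by
    rintro ⟨q, d⟩ ⟨hq, hd⟩
    rw [mem_singleton_iff] at hd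
    subst hd
    exact S.exists_nhds_injOn (hpos q hq) (hgood q hq).1 (hgood q hq).2
  obtain ⟨V, hVo, hKV, hinjV⟩ := exists_isOpen_injOn_of_isCompact hKc
    (fun p _ ↦ S.contDiff_tube.continuous.continuousAt) hinjK hloc
  -- the good open set: injective there and with injective derivative
  set W : Set ((ℝ × ℝ) × (ℝ × ℝ)) := V ∩ {p | Injective (fderiv ℝ S.tube p)} with hW
  have hWo : IsOpen W := hVo.inter S.isOpen_setOf_injective_fderiv
  have hKW : T ×ˢ ({0} : Set (ℝ × ℝ)) ⊆ W := by
    rintro ⟨q, d⟩ ⟨hq, hd⟩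
    rw [mem_singleton_iff] at hd
    subst hd
    exact ⟨hKV ⟨hq, rfl⟩, S.injective_fderiv_tube_zero (hpos q hq) (hgood q hq).1 (hgood q hq).2⟩
  obtain ⟨u, v, hu, hv, hTu, h0v, huv⟩ :=
    generalized_tube_lemma hT isCompact_singleton hWo hKW
  obtain ⟨ε, hε, hball⟩ := Metric.isOpen_iff.1 hv 0 (h0v (mem_singleton 0))
  refine ⟨ε, hε, fun p hp p' hp' h ↦ hinjV (huv ⟨hTu hp.1, hball hp.2⟩).1
    (huv ⟨hTu hp'.1, hball hp'.2⟩).1 h, fun p hp ↦ (huv ⟨hTu hp.1, hball hp.2⟩).2⟩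

end TubeSetup

end StripFrame

end Literature.Topology.FourManifolds
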